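import Mathlib
import Literature.Analysis.FluidPDE.GaussianVortexPlanar
import Literature.Analysis.FluidPDE.GaussianVortexPlanarProofs
import Literature.Analysis.FluidPDE.BiotSavart2DSymmetry
import Literature.Analysis.FluidPDE.WholeSpaceIBP
import Summits.AnomalousDissipation.AnomalousDissipation.Theorems.MarginalStabilityChainStretchedVortexRowsStubCoreLEnergyGapYControl
import Summits.AnomalousDissipation.AnomalousDissipation.Theorems.MarginalStabilityChainStretchedVortexRowsStubCoreInverseIntegrabilityClass
import Summits.AnomalousDissipation.AnomalousDissipation.Theorems.MarginalStabilityChainStretchedVortexRowsStubCoreInverseIntegrabilityTools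
import HarnessLib

/-!
# Helper `coreInverse_integrability` toward stub `stub_coreInverse` of the line `braid-closed-large-circulation-gluing`
# (crux stmt-AnomalousDissipation-3009, `MarginalStabilityChain.StretchedVortexRows`)

The integrability package (H11) of the energy method for the cut-off core operator at the Gaussian vortex
`G = gaussVortexProfile`, in ground-state variables `w = G u` (`u ∈ C²(ℝ²)`, `|u|, ‖Du‖, ‖D²u‖ ≤ M`), with the pieces

  `Lw = strainedVorticityOperator 0 w`, `Sw = χ⟪V, ∇w⟫ + ⟪∇χ, V⟫w` (`V = Bξ`, `χ ∈ C¹_c`), `Rw = ⟪v^G, ∇w⟫`,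
  `Nw = ⟪K∗w, ∇G⟫`, `Bw = ⟪K∗w, ∇w_B⟫ + ⟪K∗w_B, ∇w⟫` (`|w_B| + ‖∇w_B‖ ≤ C_B(1+|ξ|)^kG`),
  `f = Lw + Sw − α(Rw + Nw) − Bw`, `∂_θw = Dw[ξ^⊥]`, `Gi = G⁻¹`:

every field is a.e. strongly measurable (continuous, resp. built from the strongly measurable Biot–Savart velocity)
and of **Gaussian class** `|X| ≤ C(1+|ξ|)ⁿG` (`…StubCoreInverseIntegrabilityTools`:
`|w| ≤ MG`, `‖∇w‖, |∂_θw| ≤ M(1+|ξ|)G`, `|Lw| ≤ 3M(1+|ξ|)G`, `|Sw| ≤ C(1+|ξ|)²G`, `|Rw| ≤ M(1+|ξ|)²G`,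
`|Nw| ≤ C(1+|ξ|)G`, `|Bw| ≤ C(1+|ξ|)^{k+1}G`, hence `|f| ≤ C_f(1+|ξ|)^{k+2}G`), so that all twenty conclusions follow
from the bookkeeping of `…StubCoreInverseIntegrabilityClass`: `w ∈ Y` (landed `memGWSobolev_gaussVortexProfile_mul`),
`Gi w², Gi‖∇w‖² ∈ L¹` and `‖w‖²_Y = ∫Gi w² + ∫Gi‖∇w‖²`, `Gi Ω (∂_θw)² ∈ L¹`, `Gi X w, Gi X ∂_θw ∈ L¹` for
`X ∈ {Lw, Sw, Rw, Nw, Bw, f}`, `Gi(1+|ξ|²)f² ∈ L¹`, and the two Cauchy–Schwarz bounds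
`|∫Gi f w| ≤ (∫Gi(1+|ξ|²)f²)^{1/2}(∫Gi w²)^{1/2}`, `|∫Gi f ∂_θw| ≤ (∫Gi(1+|ξ|²)f²)^{1/2}(∫Gi‖∇w‖²)^{1/2}`
(using `w² ≤ (1+|ξ|²)w²` and `(∂_θw)² ≤ |ξ|²‖∇w‖² ≤ (1+|ξ|²)‖∇w‖²`).

References: Th. Gallay, C. E. Wayne, Comm. Math. Phys. 255 (2005) §4; J. Math. Fluid Mech. 9 (2007), (1.3)–(1.9);
Th. Gallay, Y. Maekawa, arXiv:1610.08384, §4.1.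
-/

set_option linter.dupNamespace false

noncomputable section

open scoped RealInnerProductSpace Topology ContDiff
open MeasureTheory WithLp Function Metric Filter Set

namespace Summit.AnomalousDissipation.AnomalousDissipation.Theorems.MarginalStabilityChainStretchedVortexRows

open Literature.Analysis.FluidPDE

/-- W3-G (H11, integrability package and data pairings for the core class): every pairing of the energy method
exists as a Lebesgue integral, `w ∈ Y`, `(1+|ξ|²)^{1/2} f ∈ L²(G⁻¹)`, `‖w‖²_Y = ‖w‖²_X + ‖∇w‖²_X`, and
`|⟨f, w⟩_X| ≤ ‖f‖_{X,1}‖w‖_X`, `|⟨f, ∂_θw⟩_X| ≤ ‖f‖_{X,1}‖∇w‖_X`. -/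
theorem coreInverse_integrability :
    ∀ (k : ℕ) (C_B α b₁ b₂ : ℝ) (χ wB u : EuclideanSpace ℝ (Fin 2) → ℝ),
      ContDiff ℝ 1 χ → HasCompactSupport χ →
      ContDiff ℝ 2 wB → (∀ ξ, |wB ξ| + ‖gradient wB ξ‖ ≤ C_B * (1 + ‖ξ‖) ^ k * gaussVortexProfile ξ) →
      ContDiff ℝ 2 u → (∃ M : ℝ, ∀ ξ, |u ξ| ≤ M ∧ ‖fderiv ℝ u ξ‖ ≤ M ∧ ‖fderiv ℝ (fderiv ℝ u) ξ‖ ≤ M) →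
      let w : EuclideanSpace ℝ (Fin 2) → ℝ := fun η => gaussVortexProfile η * u η
      let V : EuclideanSpace ℝ (Fin 2) → EuclideanSpace ℝ (Fin 2) := fun ξ =>
        toLp 2 ![b₁ * ξ 0 + b₂ * ξ 1, b₂ * ξ 0 - b₁ * ξ 1]
      let Lw : EuclideanSpace ℝ (Fin 2) → ℝ := fun ξ => strainedVorticityOperator 0 w ξ
      let Sw : EuclideanSpace ℝ (Fin 2) → ℝ := fun ξ => χ ξ * ⟪V ξ, gradient w ξ⟫ + ⟪gradient χ ξ, V ξ⟫ * w ξ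
      let Rw : EuclideanSpace ℝ (Fin 2) → ℝ := fun ξ => ⟪gaussVortexVelocity ξ, gradient w ξ⟫
      let Nw : EuclideanSpace ℝ (Fin 2) → ℝ := fun ξ => ⟪biotSavart2D w ξ, gradient gaussVortexProfile ξ⟫
      let Bw : EuclideanSpace ℝ (Fin 2) → ℝ := fun ξ =>
        ⟪biotSavart2D w ξ, gradient wB ξ⟫ + ⟪biotSavart2D wB ξ, gradient w ξ⟫
      let f : EuclideanSpace ℝ (Fin 2) → ℝ := fun ξ => Lw ξ + Sw ξ - α * (Rw ξ + Nw ξ) - Bw ξ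
      let dθw : EuclideanSpace ℝ (Fin 2) → ℝ := fun ξ => fderiv ℝ w ξ (perp ξ)
      let Gi : EuclideanSpace ℝ (Fin 2) → ℝ := fun ξ => (gaussVortexProfile ξ)⁻¹
      MemGWSobolev w ∧
        Integrable (fun ξ => Gi ξ * w ξ ^ 2) ∧ Integrable (fun ξ => Gi ξ * ‖gradient w ξ‖ ^ 2) ∧
        gwSobolevNormSq w = (∫ ξ, Gi ξ * w ξ ^ 2) + ∫ ξ, Gi ξ * ‖gradient w ξ‖ ^ 2 ∧
        Integrable (fun ξ => Gi ξ * ((8 * Real.pi)⁻¹ * burgersPhi (‖ξ‖ ^ 2 / 4)) * dθw ξ ^ 2) ∧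
        Integrable (fun ξ => Gi ξ * Lw ξ * w ξ) ∧ Integrable (fun ξ => Gi ξ * Lw ξ * dθw ξ) ∧
        Integrable (fun ξ => Gi ξ * Sw ξ * w ξ) ∧ Integrable (fun ξ => Gi ξ * Sw ξ * dθw ξ) ∧
        Integrable (fun ξ => Gi ξ * Rw ξ * w ξ) ∧ Integrable (fun ξ => Gi ξ * Rw ξ * dθw ξ) ∧
        Integrable (fun ξ => Gi ξ * Nw ξ * w ξ) ∧ Integrable (fun ξ => Gi ξ * Nw ξ * dθw ξ) ∧
        Integrable (fun ξ => Gi ξ * Bw ξ * w ξ) ∧ Integrable (fun ξ => Gi ξ * Bw ξ * dθw ξ) ∧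
        Integrable (fun ξ => Gi ξ * (1 + ‖ξ‖ ^ 2) * f ξ ^ 2) ∧
        Integrable (fun ξ => Gi ξ * f ξ * w ξ) ∧ Integrable (fun ξ => Gi ξ * f ξ * dθw ξ) ∧
        |∫ ξ, Gi ξ * f ξ * w ξ| ≤
          Real.sqrt (∫ ξ, Gi ξ * (1 + ‖ξ‖ ^ 2) * f ξ ^ 2) * Real.sqrt (∫ ξ, Gi ξ * w ξ ^ 2) ∧
        |∫ ξ, Gi ξ * f ξ * dθw ξ| ≤
          Real.sqrt (∫ ξ, Gi ξ * (1 + ‖ξ‖ ^ 2) * f ξ ^ 2) * Real.sqrt (∫ ξ, Gi ξ * ‖gradient w ξ‖ ^ 2) := by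
  intro k C_B α b₁ b₂ χ wB u hχ hχc hwB hwBb hu hM w V Lw Sw Rw Nw Bw f dθw Gi
  obtain ⟨M, hM⟩ := hM
  -- smoothness
  have hu1 : ContDiff ℝ 1 u := hu.of_le one_le_two
  have hud : Differentiable ℝ u := hu.differentiable two_ne_zero
  have hw2 : ContDiff ℝ 2 w := (contDiff_gaussVortexProfile (n := 2)).mul hu
  have hw1 : ContDiff ℝ 1 w := hw2.of_le one_le_two
  have hwc : Continuous w := hw2.continuous
  have hwBc : Continuous wB := hwB.continuous
  -- pointwise Gaussian-class bounds of the pieces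
  have hw : ∀ ξ, |w ξ| ≤ M * (1 + ‖ξ‖) ^ 0 * gaussVortexProfile ξ := abs_gauss_mul_le_of_coreBound hM
  have hDw : ∀ ξ, ‖gradient w ξ‖ ≤ M * (1 + ‖ξ‖) ^ 1 * gaussVortexProfile ξ :=
    norm_gradient_gauss_mul_le_of_coreBound hM hud
  have hθ : ∀ ξ, |dθw ξ| ≤ M * (1 + ‖ξ‖) ^ 1 * gaussVortexProfile ξ :=
    abs_angularDeriv_gauss_mul_le_of_coreBound hM hud
  have hL : ∀ ξ, |Lw ξ| ≤ 3 * M * (1 + ‖ξ‖) ^ 1 * gaussVortexProfile ξ :=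
    abs_strainedVorticityOperator_gauss_mul_le_of_coreBound hM hu
  obtain ⟨Aχ, hχb, hχb'⟩ := exists_bound_of_hasCompactSupport hχ hχc
  have hV : ∀ ξ, ‖V ξ‖ ≤ Real.sqrt (b₁ ^ 2 + b₂ ^ 2) * (1 + ‖ξ‖) ^ 1 := norm_strainField_le b₁ b₂
  have hS : ∀ ξ, |Sw ξ| ≤ (Aχ * (Real.sqrt (b₁ ^ 2 + b₂ ^ 2) * M) + Aχ * Real.sqrt (b₁ ^ 2 + b₂ ^ 2) * M) *
      (1 + ‖ξ‖) ^ 2 * gaussVortexProfile ξ := gaussClass_strainTerm hχb hχb' hV hw hDw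
  have hR : ∀ ξ, |Rw ξ| ≤ (1 * M) * (1 + ‖ξ‖) ^ (1 + 1) * gaussVortexProfile ξ :=
    gaussClass_inner_left norm_gaussVortexVelocity_le hDw
  obtain ⟨Kw, hKw⟩ := exists_norm_biotSavart2D_le_of_gaussClass hwc hw
  obtain ⟨hwBb0, hwBb1⟩ := gaussClass_of_add_bound hwBb
  obtain ⟨KB, hKB⟩ := exists_norm_biotSavart2D_le_of_gaussClass hwBc hwBb0
  have hN : ∀ ξ, |Nw ξ| ≤ (Kw * 1) * (1 + ‖ξ‖) ^ (0 + 1) * gaussVortexProfile ξ :=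
    gaussClass_inner_left hKw norm_gradient_gaussVortexProfile_le
  have hB : ∀ ξ, |Bw ξ| ≤ (Kw * C_B + KB * M) * (1 + ‖ξ‖) ^ (k + 1) * gaussVortexProfile ξ :=
    gaussClass_backgroundTerm hKw hKB hwBb1 hDw
  have hf : ∀ ξ, |f ξ| ≤ ((3 * M + (Aχ * (Real.sqrt (b₁ ^ 2 + b₂ ^ 2) * M) + Aχ * Real.sqrt (b₁ ^ 2 + b₂ ^ 2) * M)) +
      |α| * (1 * M + Kw * 1) + (Kw * C_B + KB * M)) * (1 + ‖ξ‖) ^ (k + 2) * gaussVortexProfile ξ :=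
    gaussClass_sub (gaussClass_sub (gaussClass_add (gaussClass_mono (m := k + 2) (by omega) hL)
      (gaussClass_mono (m := k + 2) (by omega) hS)) (gaussClass_const_mul α (gaussClass_add
      (gaussClass_mono (m := k + 2) (by omega) hR) (gaussClass_mono (m := k + 2) (by omega) hN))))
      (gaussClass_mono (m := k + 2) (by omega) hB)
  -- measurability of the pieces
  have hgw : Continuous (gradient w) := continuous_gradient_of_contDiff hw1
  have hwm : AEStronglyMeasurable w volume := hwc.aestronglyMeasurable
  have hθm : AEStronglyMeasurable dθw volume :=
    ((hw1.continuous_fderiv one_ne_zero).clm_apply continuous_perp).aestronglyMeasurable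
  have hLm : AEStronglyMeasurable Lw volume := (continuous_strainedVorticityOperator hw2 0).aestronglyMeasurable
  have hSm : AEStronglyMeasurable Sw volume :=
    ((hχ.continuous.mul ((continuous_strainField b₁ b₂).inner hgw)).add
      (((continuous_gradient_of_contDiff hχ).inner (continuous_strainField b₁ b₂)).mul hwc)).aestronglyMeasurable
  have hRm : AEStronglyMeasurable Rw volume := (continuous_gaussVortexVelocity.inner hgw).aestronglyMeasurable
  have hNm : AEStronglyMeasurable Nw volume :=
    (aestronglyMeasurable_biotSavart2D hwc).inner
      (continuous_gradient_of_contDiff (contDiff_gaussVortexProfile (n := 1))).aestronglyMeasurable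
  have hBm : AEStronglyMeasurable Bw volume :=
    ((aestronglyMeasurable_biotSavart2D hwc).inner (continuous_gradient_of_contDiff
      (hwB.of_le one_le_two)).aestronglyMeasurable).add
      ((aestronglyMeasurable_biotSavart2D hwBc).inner hgw.aestronglyMeasurable)
  have hfm : AEStronglyMeasurable f volume := ((hLm.add hSm).sub ((hRm.add hNm).const_mul α)).sub hBm
  -- the basic integrals
  have hIw2 : Integrable fun ξ => Gi ξ * w ξ ^ 2 := integrable_invGauss_mul_sq hwm hw
  have hIDw2 : Integrable fun ξ => Gi ξ * ‖gradient w ξ‖ ^ 2 := integrable_invGauss_mul_norm_sq hgw.aestronglyMeasurable hDw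
  have hIf2 : Integrable fun ξ => Gi ξ * (1 + ‖ξ‖ ^ 2) * f ξ ^ 2 :=
    integrable_invGauss_mul_one_add_norm_sq_mul_sq hfm hf
  have hIfw : Integrable fun ξ => Gi ξ * f ξ * w ξ := integrable_invGauss_mul_mul hfm hwm hf hw
  have hIfθ : Integrable fun ξ => Gi ξ * f ξ * dθw ξ := integrable_invGauss_mul_mul hfm hθm hf hθ
  refine ⟨memGWSobolev_gaussVortexProfile_mul hu1 (fun x => (hM x).1) (fun x => (hM x).2.1), hIw2, hIDw2,
    gwSobolevNormSq_eq_add hIw2 hIDw2, integrable_invGauss_mul_omega_mul_sq hθm hθ,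
    integrable_invGauss_mul_mul hLm hwm hL hw, integrable_invGauss_mul_mul hLm hθm hL hθ,
    integrable_invGauss_mul_mul hSm hwm hS hw, integrable_invGauss_mul_mul hSm hθm hS hθ,
    integrable_invGauss_mul_mul hRm hwm hR hw, integrable_invGauss_mul_mul hRm hθm hR hθ,
    integrable_invGauss_mul_mul hNm hwm hN hw, integrable_invGauss_mul_mul hNm hθm hN hθ,
    integrable_invGauss_mul_mul hBm hwm hB hw, integrable_invGauss_mul_mul hBm hθm hB hθ,
    hIf2, hIfw, hIfθ,
    abs_integral_invGauss_mul_mul_le hIf2 hIfw hwm hIw2 (fun ξ => ?_),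
    abs_integral_invGauss_mul_mul_le (B := fun ξ => ‖gradient w ξ‖) hIf2 hIfθ hθm hIDw2
      (fun ξ => sq_fderiv_apply_perp_le w ξ)⟩
  exact le_mul_of_one_le_left (sq_nonneg _) (le_add_of_nonneg_right (sq_nonneg _))

end Summit.AnomalousDissipation.AnomalousDissipation.Theorems.MarginalStabilityChainStretchedVortexRows

end
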